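import Literature.NumberTheory.Transcendental.CurvePeriods
import Mathlib.Topology.Algebra.MvPolynomial
import Mathlib.Analysis.Calculus.ContDiff.Deriv
import Mathlib.Analysis.Calculus.Deriv.Mul
import Mathlib.Analysis.Calculus.Deriv.Pi
import Mathlib.MeasureTheory.Integral.IntervalIntegral.FundThmCalculus
import HarnessLib

/-!
# Periods of curve type: the elementary relations evaluate to zero (easy direction)

Companion of `Literature/NumberTheory/Transcendental/CurvePeriods.lean`, which states
Huber–Wüstholz, *Transcendence and Linear Relations of 1-Periods* (Cambridge Tracts 227, 2022),
**Theorem 13.3 (2)** — all `ℚ̄`-linear relations between periods of curve type are induced by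
bilinearity and functoriality of pairs — as the named fact
`Literature.NumberTheory.Transcendental.HuberWustholzCurvePeriods` on explicit period symbols
`(Z, ω, γ)` (§3.3.1 of the book) with the elementary relations (R1)–(R5)
(`CurvePeriods.IsElementaryRelation`).

The named fact is the HARD inclusion `ker ev ⊆ span (R1)–(R5)`; its printed proof (pp. 121–122
of the book: Thm. 9.10, the period conjecture for 1-motives, resting on Wüstholz's analytic
subgroup theorem (Ch. 6); Thm. A.7, Ayoub–Barbieri-Viale's identification of Deligne 1-motives
with Nori 1-motives and the diagram category of pairs `(C, D)`; [HMS17, Thm. 8.4.22]) is far out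
of reach of Mathlib and is NOT reproduced here.

This file proves the EASY, "obvious relations" direction (book §13.1 (A), (B); §3.3 "By Stokes's
Theorem the pairing induces a well-defined map on homology") for the generators that only need
one-variable calculus, i.e. the items listed under "What is NOT here … routine" in the module
docstring of `CurvePeriods.lean`:

* `CurvePeriods.hasDerivAt_eval_comp` — the chain rule
  `d/dt P(γ(t)) = Σᵢ (∂P/∂xᵢ)(γ(t)) · γᵢ′(t)` for a multivariate polynomial along a path;
* `CurvePeriods.PeriodSymbol.intervalIntegrable_integrand` — the period integrand is integrable;
* (R1) `CurvePeriods.period_add`, `CurvePeriods.period_smul` and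
  `CurvePeriods.evalCombination_rel_add`, `CurvePeriods.evalCombination_rel_smul`;
* (R2) `CurvePeriods.period_eq_zero_of_vanishesOn` (`γ′(t)` is a tangent vector of `Z`, by the
  chain rule applied to `Fⱼ ∘ γ ≡ 0`) and `CurvePeriods.evalCombination_rel_vanish`;
* (R3) `CurvePeriods.period_formD` (`∫_γ dP = P(γ(1)) − P(γ(0))`, the fundamental theorem of
  calculus) and `CurvePeriods.evalCombination_rel_exact`;
* (R4) `CurvePeriods.period_formPullback` (`∫_γ f^*ω′ = ∫_{f∘γ} ω′`, the chain rule; book §13.1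
  (B)) and `CurvePeriods.evalCombination_rel_pushforward`.

The remaining generator (R5) (boundaries of `C¹` triangles: Stokes' theorem on a triangle for a
merely `C¹` map into `Z`, together with `dω|_{T_z Z} = 0` from the rank condition) is not treated
in this file.

## References

* A. Huber, G. Wüstholz, *Transcendence and Linear Relations of 1-Periods*, Cambridge Tracts in
  Mathematics 227, CUP 2022 [HuberWustholz2022]: §3.3 and §3.3.1 (period pairing on smooth affine
  curves, pp. 42–43 of the held text), §13.1 (A)–(B) (p. 120), Thm. 13.3 (p. 121).
-/

noncomputable section

open scoped BigOperators
open MvPolynomial Set MeasureTheory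

namespace Literature.NumberTheory.Transcendental

namespace CurvePeriods

/-! ### The chain rule for polynomial evaluation along a path -/

/-- **Chain rule** for a multivariate polynomial along a path: if every coordinate `γᵢ` has
derivative `γ′ᵢ` at `t`, then `u ↦ P(γ(u))` has derivative `Σᵢ (∂P/∂xᵢ)(γ(t)) · γ′ᵢ` at `t`
(proved by induction on `P`). [folklore] -/
theorem hasDerivAt_eval_comp {n : ℕ} {γ : ℝ → (Fin n → ℂ)} {γ' : Fin n → ℂ} {t : ℝ}
    (hγ : ∀ i, HasDerivAt (fun u => γ u i) (γ' i) t) (P : MvPolynomial (Fin n) ℂ) :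
    HasDerivAt (fun u => eval (γ u) P) (∑ i, eval (γ t) (pderiv i P) * γ' i) t := by
  induction P using MvPolynomial.induction_on with
  | C a =>
    simp only [eval_C, pderiv_C, map_zero, zero_mul, Finset.sum_const_zero]
    exact hasDerivAt_const t a
  | add p q hp hq =>
    have h := hp.add hq
    simp only [map_add, add_mul, Finset.sum_add_distrib]
    exact h
  | mul_X p i hp =>
    have h := hp.mul (hγ i)
    have key : ∀ k, eval (γ t) (pderiv k (p * X i)) * γ' k =
        eval (γ t) (pderiv k p) * γ' k * γ t i +
          (if k = i then eval (γ t) p * γ' i else 0) := by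
      intro k
      rw [pderiv_mul, map_add, map_mul, map_mul, eval_X]
      by_cases hk : k = i
      · subst hk
        rw [pderiv_X_self, map_one, if_pos rfl]
        ring
      · rw [pderiv_X_of_ne (fun h => hk h.symm), map_zero, if_neg hk]
        ring
    have hsum : (∑ k, eval (γ t) (pderiv k (p * X i)) * γ' k) =
        (∑ k, eval (γ t) (pderiv k p) * γ' k) * γ t i + eval (γ t) p * γ' i := by
      rw [Finset.sum_congr rfl fun k _ => key k, Finset.sum_add_distrib, Finset.sum_mul,
        Finset.sum_ite_eq' Finset.univ i, if_pos (Finset.mem_univ _)]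
    rw [hsum]
    have hfun : (fun u => eval (γ u) (p * X i)) = fun u => eval (γ u) p * γ u i := by
      funext u
      rw [map_mul, eval_X]
    rw [hfun]
    exact h

/-! ### Calculus of `C¹` paths on `[0, 1]` -/

variable {Z : CurveData}

/-- Each coordinate of a `C¹` path is `C¹` on `[0,1]`. [folklore] -/
theorem CurvePath.contDiffOn_apply (γ : CurvePath Z) (i : Fin Z.n) :
    ContDiffOn ℝ 1 (fun u => γ.toFun u i) (Icc 0 1) :=
  contDiffOn_pi.1 γ.contDiffOn i

/-- At interior times a `C¹` path on `[0,1]` is differentiable, with derivative `deriv`.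
[folklore] -/
theorem CurvePath.hasDerivAt (γ : CurvePath Z) {t : ℝ} (ht : t ∈ Ioo (0 : ℝ) 1) (i : Fin Z.n) :
    HasDerivAt (fun u => γ.toFun u i) (deriv (fun u => γ.toFun u i) t) t :=
  (((γ.contDiffOn_apply i).differentiableOn one_ne_zero).differentiableAt
    (Icc_mem_nhds ht.1 ht.2)).hasDerivAt

/-- The one-sided derivative of a coordinate of a `C¹` path is continuous on `[0,1]`.
[folklore] -/
theorem CurvePath.continuousOn_derivWithin (γ : CurvePath Z) (i : Fin Z.n) :
    ContinuousOn (derivWithin (fun u => γ.toFun u i) (Icc 0 1)) (Icc 0 1) :=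
  (γ.contDiffOn_apply i).continuousOn_derivWithin (uniqueDiffOn_Icc zero_lt_one) le_rfl

/-- On the open interval the one-sided derivative is the derivative. [folklore] -/
theorem CurvePath.derivWithin_eq_deriv (γ : CurvePath Z) {t : ℝ} (ht : t ∈ Ioo (0 : ℝ) 1)
    (i : Fin Z.n) :
    derivWithin (fun u => γ.toFun u i) (Icc 0 1) t = deriv (fun u => γ.toFun u i) t :=
  derivWithin_of_mem_nhds (Icc_mem_nhds ht.1 ht.2)

/-- A `C¹` path is continuous on `[0,1]`. [folklore] -/
theorem CurvePath.continuousOn (γ : CurvePath Z) : ContinuousOn γ.toFun (Icc 0 1) :=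
  γ.contDiffOn.continuousOn

/-- Polynomials are continuous along a `C¹` path on `[0,1]`. [folklore] -/
theorem CurvePath.continuousOn_eval (γ : CurvePath Z) (P : MvPolynomial (Fin Z.n) ℂ) :
    ContinuousOn (fun t => eval (γ.toFun t) P) (Icc 0 1) :=
  (MvPolynomial.continuous_eval P).comp_continuousOn γ.continuousOn

/-- **The velocity of a path on `Z` is tangent to `Z`**: for `t ∈ (0,1)`,
`γ′(t) ∈ T_{γ(t)} Z`, by the chain rule applied to `Fⱼ(γ(t)) ≡ 0`. [folklore] -/
theorem CurvePath.deriv_mem_tangentSpace (γ : CurvePath Z) {t : ℝ} (ht : t ∈ Ioo (0 : ℝ) 1) :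
    (fun i => deriv (fun u => γ.toFun u i) t) ∈ Z.tangentSpace (γ.toFun t) := by
  intro j
  -- `u ↦ Fⱼ(γ(u))` vanishes on `[0,1]`, a neighbourhood of `t`, so its derivative at `t` is `0`.
  have hD := hasDerivAt_eval_comp (fun i => γ.hasDerivAt ht i) (Z.F j)
  have hzero : (fun u => eval (γ.toFun u) (Z.F j)) =ᶠ[nhds t] fun _ => (0 : ℂ) := by
    filter_upwards [Icc_mem_nhds ht.1 ht.2] with u hu
    exact (CurveData.mem_points.1 (γ.mem_points u hu)) j
  have hD0 : HasDerivAt (fun u => eval (γ.toFun u) (Z.F j)) 0 t :=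
    (hasDerivAt_const t (0 : ℂ)).congr_of_eventuallyEq hzero
  have := hD.unique hD0
  simpa [CurveData.gradient] using this

/-! ### The period integrand -/

/-- The period integrand agrees on `(0,1)` with the continuous function obtained by replacing
`deriv` with the one-sided derivative `derivWithin … [0,1]`. [folklore] -/
theorem PeriodSymbol.integrand_eqOn (s : PeriodSymbol) :
    EqOn (fun t => ∑ i, eval (s.γ.toFun t) (s.ω i) * deriv (fun u => s.γ.toFun u i) t)
      (fun t => ∑ i, eval (s.γ.toFun t) (s.ω i) *
        derivWithin (fun u => s.γ.toFun u i) (Icc 0 1) t) (Ioo 0 1) :=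
  fun _ ht => Finset.sum_congr rfl fun i _ => by rw [s.γ.derivWithin_eq_deriv ht i]

/-- The one-sided period integrand is continuous on `[0,1]`. [folklore] -/
theorem PeriodSymbol.continuousOn_integrand (s : PeriodSymbol) :
    ContinuousOn (fun t => ∑ i, eval (s.γ.toFun t) (s.ω i) *
      derivWithin (fun u => s.γ.toFun u i) (Icc 0 1) t) (Icc 0 1) :=
  continuousOn_finsetSum _ fun i _ =>
    (s.γ.continuousOn_eval (s.ω i)).mul (s.γ.continuousOn_derivWithin i)

/-- **The period integrand is integrable on `[0,1]`.** [folklore] -/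
theorem PeriodSymbol.intervalIntegrable_integrand (s : PeriodSymbol) :
    IntervalIntegrable
      (fun t => ∑ i, eval (s.γ.toFun t) (s.ω i) * deriv (fun u => s.γ.toFun u i) t)
      volume 0 1 := by
  rw [intervalIntegrable_iff_integrableOn_Ioo_of_le zero_le_one]
  exact ((s.continuousOn_integrand.integrableOn_compact isCompact_Icc).mono_set
    Ioo_subset_Icc_self).congr_fun s.integrand_eqOn.symm measurableSet_Ioo

/-- The period as an integral over the open interval `(0,1)`. [folklore] -/
theorem PeriodSymbol.period_eq_integral_Ioo (s : PeriodSymbol) :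
    s.period = ∫ t in Ioo (0 : ℝ) 1,
      ∑ i, eval (s.γ.toFun t) (s.ω i) * deriv (fun u => s.γ.toFun u i) t := by
  rw [PeriodSymbol.period, intervalIntegral.integral_of_le zero_le_one,
    integral_Ioc_eq_integral_Ioo]

/-- Two symbols whose period integrands agree on `(0,1)` have the same period. [folklore] -/
theorem PeriodSymbol.period_eq_of_eqOn {s s' : PeriodSymbol}
    (h : EqOn (fun t => ∑ i, eval (s.γ.toFun t) (s.ω i) * deriv (fun u => s.γ.toFun u i) t)
      (fun t => ∑ i, eval (s'.γ.toFun t) (s'.ω i) * deriv (fun u => s'.γ.toFun u i) t)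
      (Ioo 0 1)) :
    s.period = s'.period := by
  rw [s.period_eq_integral_Ioo, s'.period_eq_integral_Ioo]
  exact setIntegral_congr_fun measurableSet_Ioo h

/-! ### (R1) Linearity in the form -/

/-- **(R1a)** `∫_γ (ω₁ + ω₂) = ∫_γ ω₁ + ∫_γ ω₂` (bilinearity, book §13.1 (A)).
[cite: HuberWustholz2022, §13.1 (A) (p. 120)] -/
theorem period_add (Z : CurveData) (hZ : Z.IsSmoothAffineCurve) (γ : CurvePath Z)
    (ω₁ ω₂ : Fin Z.n → MvPolynomial (Fin Z.n) ℂ) (h : ∀ i, HasAlgCoeffs ((ω₁ + ω₂) i))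
    (h₁ : ∀ i, HasAlgCoeffs (ω₁ i)) (h₂ : ∀ i, HasAlgCoeffs (ω₂ i)) :
    (⟨Z, hZ, ω₁ + ω₂, h, γ⟩ : PeriodSymbol).period =
      (⟨Z, hZ, ω₁, h₁, γ⟩ : PeriodSymbol).period + (⟨Z, hZ, ω₂, h₂, γ⟩ : PeriodSymbol).period := by
  have I₁ := PeriodSymbol.intervalIntegrable_integrand ⟨Z, hZ, ω₁, h₁, γ⟩
  have I₂ := PeriodSymbol.intervalIntegrable_integrand ⟨Z, hZ, ω₂, h₂, γ⟩
  have e := intervalIntegral.integral_add I₁ I₂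
  simp only [PeriodSymbol.period] at e ⊢
  rw [← e]
  refine intervalIntegral.integral_congr fun t _ => ?_
  simp only [Pi.add_apply, map_add, add_mul, Finset.sum_add_distrib]

/-- **(R1b)** `∫_γ (a · ω) = a · ∫_γ ω` (bilinearity, book §13.1 (A)).
[cite: HuberWustholz2022, §13.1 (A) (p. 120)] -/
theorem period_smul (Z : CurveData) (hZ : Z.IsSmoothAffineCurve) (γ : CurvePath Z) (a : ℂ)
    (ω : Fin Z.n → MvPolynomial (Fin Z.n) ℂ) (h : ∀ i, HasAlgCoeffs (ω i))
    (h' : ∀ i, HasAlgCoeffs ((a • ω) i)) :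
    (⟨Z, hZ, a • ω, h', γ⟩ : PeriodSymbol).period = a * (⟨Z, hZ, ω, h, γ⟩ : PeriodSymbol).period := by
  simp only [PeriodSymbol.period]
  rw [← intervalIntegral.integral_const_mul]
  refine intervalIntegral.integral_congr fun t _ => ?_
  simp only [Pi.smul_apply, smul_eq_C_mul, map_mul, eval_C, Finset.mul_sum, mul_assoc]

/-- The relation **(R1a)** `add` evaluates to `0`. [cite: HuberWustholz2022, §13.1 (A) (p. 120)] -/
theorem evalCombination_rel_add (Z : CurveData) (hZ : Z.IsSmoothAffineCurve) (γ : CurvePath Z)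
    (ω ω₁ ω₂ : Fin Z.n → MvPolynomial (Fin Z.n) ℂ) (h : ∀ i, HasAlgCoeffs (ω i))
    (h₁ : ∀ i, HasAlgCoeffs (ω₁ i)) (h₂ : ∀ i, HasAlgCoeffs (ω₂ i)) (hω : ω = ω₁ + ω₂) :
    evalCombination
      (Finsupp.single ⟨Z, hZ, ω, h, γ⟩ 1 - Finsupp.single ⟨Z, hZ, ω₁, h₁, γ⟩ 1 -
        Finsupp.single ⟨Z, hZ, ω₂, h₂, γ⟩ 1) = 0 := by
  subst hω
  rw [sub_eq_add_neg, sub_eq_add_neg, evalCombination_add, evalCombination_add,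
    ← neg_one_smul ℂ (Finsupp.single (⟨Z, hZ, ω₁, h₁, γ⟩ : PeriodSymbol) (1 : ℂ)),
    ← neg_one_smul ℂ (Finsupp.single (⟨Z, hZ, ω₂, h₂, γ⟩ : PeriodSymbol) (1 : ℂ)),
    evalCombination_smul, evalCombination_smul, evalCombination_single, evalCombination_single,
    evalCombination_single, period_add Z hZ γ ω₁ ω₂ h h₁ h₂]
  ring

/-- The relation **(R1b)** `smul` evaluates to `0`. [cite: HuberWustholz2022, §13.1 (A) (p. 120)] -/
theorem evalCombination_rel_smul (Z : CurveData) (hZ : Z.IsSmoothAffineCurve) (γ : CurvePath Z)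
    (a : ℂ) (ω ω' : Fin Z.n → MvPolynomial (Fin Z.n) ℂ) (h : ∀ i, HasAlgCoeffs (ω i))
    (h' : ∀ i, HasAlgCoeffs (ω' i)) (hω : ω' = a • ω) :
    evalCombination
      (Finsupp.single ⟨Z, hZ, ω', h', γ⟩ 1 - a • Finsupp.single ⟨Z, hZ, ω, h, γ⟩ 1) = 0 := by
  subst hω
  rw [sub_eq_add_neg, evalCombination_add, ← neg_smul, evalCombination_smul,
    evalCombination_single, evalCombination_single, period_smul Z hZ γ a ω h h']
  ring

/-! ### (R2) Forms vanishing on the curve -/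

/-- **(R2)** If `ω` vanishes on the tangent spaces of `Z`, then `∫_γ ω = 0` for every path on
`Z`: the integrand vanishes on `(0,1)` because `γ′(t)` is tangent to `Z`. [folklore] -/
theorem period_eq_zero_of_vanishesOn (Z : CurveData) (hZ : Z.IsSmoothAffineCurve)
    (γ : CurvePath Z) (ω : Fin Z.n → MvPolynomial (Fin Z.n) ℂ) (h : ∀ i, HasAlgCoeffs (ω i))
    (hv : VanishesOn Z ω) :
    (⟨Z, hZ, ω, h, γ⟩ : PeriodSymbol).period = 0 := by
  rw [PeriodSymbol.period_eq_integral_Ioo]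
  refine (setIntegral_congr_fun measurableSet_Ioo (g := fun _ => (0 : ℂ)) fun t ht => ?_).trans
    (by simp)
  exact hv (γ.toFun t) (γ.mem_points t (Ioo_subset_Icc_self ht)) _ (γ.deriv_mem_tangentSpace ht)

/-- The relation **(R2)** `vanish` evaluates to `0`. [folklore] -/
theorem evalCombination_rel_vanish (Z : CurveData) (hZ : Z.IsSmoothAffineCurve)
    (γ : CurvePath Z) (ω : Fin Z.n → MvPolynomial (Fin Z.n) ℂ) (h : ∀ i, HasAlgCoeffs (ω i))
    (hv : VanishesOn Z ω) :
    evalCombination (Finsupp.single ⟨Z, hZ, ω, h, γ⟩ 1) = 0 := by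
  rw [evalCombination_single, period_eq_zero_of_vanishesOn Z hZ γ ω h hv, mul_zero]

/-! ### (R3) Exact forms -/

/-- **(R3)** `∫_γ dP = P(γ(1)) − P(γ(0))` (fundamental theorem of calculus; the class
`(dP, P|_D) = 0` of book §3.3.1). [cite: HuberWustholz2022, §3.3.1 (pp. 42–43)] -/
theorem period_formD (Z : CurveData) (hZ : Z.IsSmoothAffineCurve) (γ : CurvePath Z)
    (P : MvPolynomial (Fin Z.n) ℂ) (h : ∀ i, HasAlgCoeffs (formD P i)) :
    (⟨Z, hZ, formD P, h, γ⟩ : PeriodSymbol).period = eval (γ.toFun 1) P - eval (γ.toFun 0) P := by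
  have hint := PeriodSymbol.intervalIntegrable_integrand ⟨Z, hZ, formD P, h, γ⟩
  exact intervalIntegral.integral_eq_sub_of_hasDerivAt_of_le zero_le_one (γ.continuousOn_eval P)
    (fun t ht => hasDerivAt_eval_comp (fun i => γ.hasDerivAt ht i) P) hint

/-- The relation **(R3)** `exact` evaluates to `0`. [cite: HuberWustholz2022, §3.3.1 (pp. 42–43)] -/
theorem evalCombination_rel_exact (Z : CurveData) (hZ : Z.IsSmoothAffineCurve) (γ : CurvePath Z)
    (P : MvPolynomial (Fin Z.n) ℂ) (ω : Fin Z.n → MvPolynomial (Fin Z.n) ℂ)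
    (h : ∀ i, HasAlgCoeffs (ω i)) (hω : ω = formD P) :
    evalCombination
      (Finsupp.single ⟨Z, hZ, ω, h, γ⟩ 1 -
        (eval (γ.toFun 1) P - eval (γ.toFun 0) P) • Finsupp.single PeriodSymbol.unit 1) = 0 := by
  subst hω
  rw [sub_eq_add_neg, evalCombination_add, ← neg_smul, evalCombination_smul,
    evalCombination_single, evalCombination_single, period_unit, period_formD Z hZ γ P h]
  ring

/-! ### (R4) Functoriality along polynomial maps -/

/-- Evaluation of a substituted polynomial: `(bind₁ f q)(z) = q(f₁(z), …, f_{n′}(z))`.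
[folklore] -/
theorem eval_bind₁_eq {n n' : ℕ} (z : Fin n → ℂ) (f : Fin n' → MvPolynomial (Fin n) ℂ)
    (q : MvPolynomial (Fin n') ℂ) :
    eval z (bind₁ f q) = eval (fun j => eval z (f j)) q :=
  eval₂Hom_bind₁ _ _ _ _

/-- **(R4)** `∫_γ f^*ω′ = ∫_{f∘γ} ω′` for a polynomial map `f` and a path `γ′` agreeing with
`f ∘ γ` on `[0,1]` (functoriality, book §13.1 (B); the chain rule).
[cite: HuberWustholz2022, §13.1 (B) (p. 120)] -/
theorem period_formPullback (Z Z' : CurveData) (hZ : Z.IsSmoothAffineCurve)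
    (hZ' : Z'.IsSmoothAffineCurve) (f : Fin Z'.n → MvPolynomial (Fin Z.n) ℂ)
    (ω' : Fin Z'.n → MvPolynomial (Fin Z'.n) ℂ) (h' : ∀ j, HasAlgCoeffs (ω' j))
    (h : ∀ i, HasAlgCoeffs (formPullback f ω' i)) (γ : CurvePath Z) (γ' : CurvePath Z')
    (hγ' : ∀ t ∈ Icc (0 : ℝ) 1, γ'.toFun t = fun j => eval (γ.toFun t) (f j)) :
    (⟨Z, hZ, formPullback f ω', h, γ⟩ : PeriodSymbol).period =
      (⟨Z', hZ', ω', h', γ'⟩ : PeriodSymbol).period := by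
  refine PeriodSymbol.period_eq_of_eqOn fun t ht => ?_
  -- the derivative of `γ′ⱼ = fⱼ ∘ γ` at `t ∈ (0,1)`
  have hderiv : ∀ j, deriv (fun u => γ'.toFun u j) t =
      ∑ i, eval (γ.toFun t) (pderiv i (f j)) * deriv (fun u => γ.toFun u i) t := by
    intro j
    have hfj := hasDerivAt_eval_comp (fun i => γ.hasDerivAt ht i) (f j)
    have heq : (fun u => γ'.toFun u j) =ᶠ[nhds t] fun u => eval (γ.toFun u) (f j) := by
      filter_upwards [Icc_mem_nhds ht.1 ht.2] with u hu
      rw [hγ' u hu]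
    exact (hfj.congr_of_eventuallyEq heq).deriv
  have hpt : γ'.toFun t = fun j => eval (γ.toFun t) (f j) := hγ' t (Ioo_subset_Icc_self ht)
  simp only
  simp_rw [hderiv, hpt, formPullback, map_sum, map_mul, eval_bind₁_eq, Finset.sum_mul,
    Finset.mul_sum]
  rw [Finset.sum_comm]
  refine Finset.sum_congr rfl fun i _ => Finset.sum_congr rfl fun j _ => ?_
  ring

/-- The relation **(R4)** `pushforward` evaluates to `0`.
[cite: HuberWustholz2022, §13.1 (B) (p. 120)] -/
theorem evalCombination_rel_pushforward (Z Z' : CurveData) (hZ : Z.IsSmoothAffineCurve)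
    (hZ' : Z'.IsSmoothAffineCurve) (f : Fin Z'.n → MvPolynomial (Fin Z.n) ℂ)
    (ω' : Fin Z'.n → MvPolynomial (Fin Z'.n) ℂ) (h' : ∀ j, HasAlgCoeffs (ω' j))
    (ω : Fin Z.n → MvPolynomial (Fin Z.n) ℂ) (h : ∀ i, HasAlgCoeffs (ω i))
    (hω : ω = formPullback f ω') (γ : CurvePath Z) (γ' : CurvePath Z')
    (hγ' : ∀ t ∈ Icc (0 : ℝ) 1, γ'.toFun t = fun j => eval (γ.toFun t) (f j)) :
    evalCombination
      (Finsupp.single ⟨Z, hZ, ω, h, γ⟩ 1 - Finsupp.single ⟨Z', hZ', ω', h', γ'⟩ 1) = 0 := by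
  subst hω
  rw [sub_eq_add_neg, evalCombination_add,
    ← neg_one_smul ℂ (Finsupp.single (⟨Z', hZ', ω', h', γ'⟩ : PeriodSymbol) (1 : ℂ)),
    evalCombination_smul, evalCombination_single, evalCombination_single,
    period_formPullback Z Z' hZ hZ' f ω' h' h γ γ' hγ']
  ring

end CurvePeriods

end Literature.NumberTheory.Transcendental

end
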